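import Summits.QuantumFields.YangMills.Theorems.FemtoTransferGapRungW1up
import Summits.QuantumFields.YangMills.Theorems.FemtoTransferGapAdjoint
import Summits.QuantumFields.YangMills.Theorems.LuscherReductionOneSiteLevelsLinkMoments
import Summits.QuantumFields.YangMills.Theorems.LuscherReductionOneSiteLevelsIMS
import HarnessLib

/-!
# Crux `DressedRitz` (stmt-QuantumFields-20205), line «polyakovlift» r6, wave 2 / F8b — the configuration distance `cfgDist` and the KERNEL SECOND MOMENT
# `∫_V K_B(U,V)·cfgDist(U,V) dV ≤ (9/B)·c_B^{|E|}` on the one-site lattice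

Support module (fleet seat ym-20205-polyakovlift-s1 gen 2, for the LEAD's wave-2 brief W2-F8 of `WAVE-2-BRIEFS.md`; `--supports stmt-QuantumFields-20205`,
helper, no closure claim).  In the LEAD's S-PSCAL″ assembly (F9) the soft error `(g∘p_L)·η` of the one-site shadow of a transplanted observable is controlled in
the ENERGY form `P(x) = λ₀‖x‖² − ⟨x,K_Bx⟩` by the energy-norm product lemma (F8a, pen infvol-p1 g7): `P(fη) ≤ ‖f‖∞²‖η‖‖(λ₀−K_B)η‖ + ½·M·Lip(f)²·‖η‖²` where
`M ≥ sup_U ∫_V K_B(U,V)·D(U,V)` for a distance-like `D` with `(f U − f V)² ≤ Lip(f)²·D(U,V)`.  This file supplies the one-site `D` and its row moment `M`: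

* `cfgDist U V := Σ_e ‖U_e V_e⁻¹ − 1‖_F²` (`= Σ_e 4(1 − u₀(U_eV_e⁻¹))`, `cfgDist_eq_scalarPart`): nonnegative, symmetric (`cfgDist_comm`), `≤ 24`, vanishing on
  the diagonal, jointly continuous ∕ measurable;
* `integral_linkE_mul_frobSq` — per link, EXACTLY `∫_V E_B(U,V)·‖U_eV_e⁻¹ − 1‖_F² dV = linkM2 B · (linkC B)²` (product Haar measure, translation invariance);
  `integral_linkE_mul_cfgDist` — `∫_V E_B(U,V)·cfgDist(U,V) dV = 3·linkM2 B·(linkC B)²`;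
* ★ `integral_transferKernel_mul_cfgDist_le` — **`∫_V K_B(U,V)·cfgDist(U,V) dV ≤ (9/B)·linkCE B`** for every `U` and `B > 0` (`K_B ≤ E_B`: the magnetic
  Boltzmann factors are `≤ 1`; sharp one-link second moment `linkM2 B ≤ (3/B)·linkC B`, `linkCE = linkC³`);
* `exists_linkCE_le_two_mul_levelValue_zero` — `∃ B₀, ∀ B ≥ B₀, linkCE B ≤ 2·λ₀(B,1)` (the W1-up rung's `secondValue_ge` at `r = λ_b(B)`), so that the row
  moment is `≤ (18/B)·λ₀`: with `Lip(g∘p_L)² = O(L²)` (F8c) and `B = 2L³/Λ³` the product-lemma error is `O(Λ³/L)·λ₀‖η‖²`, soft.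

HONEST FRAMING: one-site kernel algebra at fixed lattice on the conditional femto rung R2b1; serves ONE stub's (S-PSCAL″) soft error; no stub closed; nothing here
bears on infinite volume, the continuum limit or the Clay gap.
References: I. Montvay, G. Münster, *Quantum Fields on a Lattice* (1994) §3.2.3 (3.96)–(3.97) [cite: MontvayMunster1994, §3.2.3 (3.96)-(3.97) p.121];
E. Seiler, LNP 159 (1982) §3 [cite: SeilerLNP1982, §3]; M. Lüscher, NPB 219 (1983) 233 [cite: Luscher1983, §2–§3].
-/

set_option autoImplicit false

noncomputable section

open MeasureTheory Filter Topology Real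
open scoped Matrix ComplexConjugate BigOperators
open Literature.MathematicalPhysics.QuantumFieldTheory
open Literature.MathematicalPhysics.QuantumLattice

namespace Summit.QuantumFields.YangMills.Theorems.FemtoTransferGap.PolyakovLift

open Summit.QuantumFields.YangMills.Theorems.FemtoTransferGap

/-! ## §1 The configuration distance -/

/-- **`cfgDist U V = Σ_e ‖U_e·V_e⁻¹ − 1‖_F²`** — the sum over the three links of the squared Hilbert–Schmidt distance of the relative link `U_eV_e⁻¹` to the
identity (bi-invariant, symmetric, `= Σ_e 4(1 − u₀(U_eV_e⁻¹))`). [cite: SeilerLNP1982, §3] -/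
def cfgDist (U V : Cfg) : ℝ :=
  ∑ e : Edge 3 1, frobNorm (((U e * (V e)⁻¹ : SU2) : Matrix (Fin 2) (Fin 2) ℂ) - 1) ^ 2

/-- `‖W⁻¹ − 1‖_F² = ‖W − 1‖_F²` on `SU(2)` (`Re tr W⁻¹ = Re tr W`). [folklore] -/
theorem frobSq_inv (W : SU2) :
    frobNorm (((W⁻¹ : SU2) : Matrix (Fin 2) (Fin 2) ℂ) - 1) ^ 2 = frobNorm ((W : Matrix (Fin 2) (Fin 2) ℂ) - 1) ^ 2 := by
  rw [frobNorm_sub_one_sq, frobNorm_sub_one_sq, re_trace_inv]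

/-- `cfgDist` in quaternion form: `cfgDist U V = Σ_e 4(1 − u₀(U_eV_e⁻¹))`. [cite: BrockerTomDieck1985, I (1.10)] -/
theorem cfgDist_eq_scalarPart (U V : Cfg) : cfgDist U V = ∑ e : Edge 3 1, 4 * (1 - scalarPart (U e * (V e)⁻¹)) := by
  unfold cfgDist
  exact Finset.sum_congr rfl fun e _ => frobNorm_sub_one_sq_eq_scalarPart _

/-- `cfgDist` is symmetric. [folklore] -/
theorem cfgDist_comm (U V : Cfg) : cfgDist U V = cfgDist V U := by
  unfold cfgDist
  refine Finset.sum_congr rfl fun e _ => ?_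
  rw [show V e * (U e)⁻¹ = (U e * (V e)⁻¹)⁻¹ by rw [mul_inv_rev, inv_inv], frobSq_inv]

/-- `0 ≤ cfgDist`. [folklore] -/
theorem cfgDist_nonneg (U V : Cfg) : 0 ≤ cfgDist U V := Finset.sum_nonneg fun _ _ => sq_nonneg _

/-- `cfgDist ≤ 24` (`‖W − 1‖_F² ≤ 8` per link, three links). [folklore] -/
theorem cfgDist_le (U V : Cfg) : cfgDist U V ≤ 24 := by
  unfold cfgDist
  calc ∑ e : Edge 3 1, frobNorm (((U e * (V e)⁻¹ : SU2) : Matrix (Fin 2) (Fin 2) ℂ) - 1) ^ 2 ≤ ∑ _e : Edge 3 1, (8 : ℝ) :=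
        Finset.sum_le_sum fun e _ => frobNorm_sub_one_sq_le_eight _
    _ = 24 := by rw [Finset.sum_const, Finset.card_univ, card_edge_one]; norm_num

/-- `|cfgDist| ≤ 24`. [folklore] -/
theorem abs_cfgDist_le (U V : Cfg) : |cfgDist U V| ≤ 24 := by
  rw [abs_of_nonneg (cfgDist_nonneg U V)]; exact cfgDist_le U V

/-- `cfgDist U U = 0`. [folklore] -/
theorem cfgDist_self (U : Cfg) : cfgDist U U = 0 := by
  unfold cfgDist
  refine Finset.sum_eq_zero fun e _ => ?_
  rw [mul_inv_cancel]
  simp [frobNorm]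

/-- `cfgDist` is jointly continuous. [folklore] -/
theorem continuous_cfgDist : Continuous fun p : Cfg × Cfg => cfgDist p.1 p.2 := by
  unfold cfgDist
  refine continuous_finsetSum _ fun e _ => ?_
  exact ((continuous_frobNorm'.comp ((continuous_subtype_val.comp
    (((continuous_apply e).comp continuous_fst).mul ((continuous_apply e).comp continuous_snd).inv)).sub continuous_const)).pow 2)

/-- `cfgDist` is jointly measurable. [folklore] -/
theorem measurable_cfgDist : Measurable fun p : Cfg × Cfg => cfgDist p.1 p.2 := by
  haveI := secondCountableTopology_su2
  exact continuous_cfgDist.measurable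

/-- `V ↦ cfgDist U V` is continuous. [folklore] -/
theorem continuous_cfgDist_right (U : Cfg) : Continuous fun V : Cfg => cfgDist U V := by
  unfold cfgDist
  refine continuous_finsetSum _ fun e _ => ?_
  exact ((continuous_frobNorm'.comp ((continuous_subtype_val.comp
    (continuous_const.mul ((continuous_apply e).inv))).sub continuous_const)).pow 2)

/-- `V ↦ cfgDist U V` is measurable. [folklore] -/
theorem measurable_cfgDist_right (U : Cfg) : Measurable fun V : Cfg => cfgDist U V := by
  haveI := secondCountableTopology_su2
  exact (continuous_cfgDist_right U).measurable

/-! ## §2 The electric row moment, exactly -/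

/-- The per-link weighted factor `v ↦ w_B(u v⁻¹)·‖u v⁻¹ − 1‖_F²` integrates to `linkM2 B` (translation invariance of Haar). [folklore] -/
theorem integral_linkW_mul_frobSq (B : ℝ) (u : SU2) :
    ∫ v, linkW B (u * v⁻¹) * frobNorm (((u * v⁻¹ : SU2) : Matrix (Fin 2) (Fin 2) ℂ) - 1) ^ 2 ∂haarProbability SU2 = linkM2 B := by
  rw [integral_comp_mul_inv_left (fun W : SU2 => linkW B W * frobNorm ((W : Matrix (Fin 2) (Fin 2) ℂ) - 1) ^ 2) u]
  unfold linkM2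
  exact integral_congr_ae (Eventually.of_forall fun W => mul_comm _ _)

/-- ★ **Per link: `∫_V E_B(U,V)·‖U_eV_e⁻¹ − 1‖_F² dV = linkM2 B · (linkC B)^{|E|−1}`** (product Haar measure; the factor of link `e` carries the weight, the
others integrate to `c_B`). [cite: SeilerLNP1982, §3] -/
theorem integral_linkE_mul_frobSq (B : ℝ) (U : Cfg) (e : Edge 3 1) :
    ∫ V, linkE B U V * frobNorm (((U e * (V e)⁻¹ : SU2) : Matrix (Fin 2) (Fin 2) ℂ) - 1) ^ 2 ∂configMeasure SU2 1 =
      linkM2 B * linkC B ^ (Fintype.card (Edge 3 1) - 1) := by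
  classical
  -- the integrand as a product over links
  set F : Edge 3 1 → SU2 → ℝ := fun e' v =>
    linkW B (U e' * v⁻¹) * (if e' = e then frobNorm (((U e' * v⁻¹ : SU2) : Matrix (Fin 2) (Fin 2) ℂ) - 1) ^ 2 else 1) with hF
  have hprod : ∀ V : Cfg, linkE B U V * frobNorm (((U e * (V e)⁻¹ : SU2) : Matrix (Fin 2) (Fin 2) ℂ) - 1) ^ 2 = ∏ e', F e' (V e') := by
    intro V
    simp only [hF, linkE]
    rw [Finset.prod_mul_distrib, Finset.prod_ite_eq' Finset.univ e, if_pos (Finset.mem_univ e)]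
  simp_rw [hprod]
  rw [show (∫ V, ∏ e', F e' (V e') ∂configMeasure SU2 1) = ∏ e' : Edge 3 1, ∫ v, F e' v ∂haarProbability SU2 from
    integral_fintype_prod_eq_prod F]
  -- the factors
  have hfac : ∀ e', ∫ v, F e' v ∂haarProbability SU2 = if e' = e then linkM2 B else linkC B := by
    intro e'
    by_cases h : e' = e
    · subst h
      simp only [hF, if_true]
      exact integral_linkW_mul_frobSq B (U e')
    · simp only [hF, if_neg h, mul_one]
      rw [integral_comp_mul_inv_left (linkW B) (U e')]
      rfl
  simp_rw [hfac]
  rw [← Finset.mul_prod_erase Finset.univ _ (Finset.mem_univ e), if_pos rfl]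
  congr 1
  rw [Finset.prod_congr rfl fun e' he' => if_neg (Finset.ne_of_mem_erase he'), Finset.prod_const, Finset.card_erase_of_mem (Finset.mem_univ e),
    Finset.card_univ]

/-- The per-link integrand is integrable (bounded measurable on a probability space). [folklore] -/
theorem integrable_linkE_mul_frobSq {B : ℝ} (hB : 0 ≤ B) (U : Cfg) (e : Edge 3 1) :
    Integrable (fun V : Cfg => linkE B U V * frobNorm (((U e * (V e)⁻¹ : SU2) : Matrix (Fin 2) (Fin 2) ℂ) - 1) ^ 2) (configMeasure SU2 1) := by
  haveI := secondCountableTopology_su2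
  have hm : Measurable fun V : Cfg => linkE B U V * frobNorm (((U e * (V e)⁻¹ : SU2) : Matrix (Fin 2) (Fin 2) ℂ) - 1) ^ 2 :=
    (((continuous_linkE B).comp (continuous_const.prodMk continuous_id)).mul ((continuous_frobNorm'.comp ((continuous_subtype_val.comp
      (continuous_const.mul ((continuous_apply e).inv))).sub continuous_const)).pow 2)).measurable
  refine integrable_of_measurable_abs_le _ hm (C := Real.exp (2 * B) ^ Fintype.card (Edge 3 1) * 8) fun V => ?_
  rw [abs_mul, abs_of_nonneg (sq_nonneg (frobNorm (((U e * (V e)⁻¹ : SU2) : Matrix (Fin 2) (Fin 2) ℂ) - 1)))]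
  exact mul_le_mul (abs_linkE_le hB _ _) (frobNorm_sub_one_sq_le_eight _) (sq_nonneg _) (by positivity)

/-- ★ **`∫_V E_B(U,V)·cfgDist(U,V) dV = 3·linkM2 B·(linkC B)²`**. [cite: SeilerLNP1982, §3] -/
theorem integral_linkE_mul_cfgDist {B : ℝ} (hB : 0 ≤ B) (U : Cfg) :
    ∫ V, linkE B U V * cfgDist U V ∂configMeasure SU2 1 = 3 * (linkM2 B * linkC B ^ 2) := by
  have hsum : ∀ V : Cfg, linkE B U V * cfgDist U V =
      ∑ e : Edge 3 1, linkE B U V * frobNorm (((U e * (V e)⁻¹ : SU2) : Matrix (Fin 2) (Fin 2) ℂ) - 1) ^ 2 := fun V => by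
    unfold cfgDist; rw [Finset.mul_sum]
  simp_rw [hsum]
  rw [integral_finsetSum _ fun e _ => integrable_linkE_mul_frobSq hB U e]
  simp_rw [integral_linkE_mul_frobSq B U, card_edge_one]
  rw [Finset.sum_const, Finset.card_univ, card_edge_one]
  norm_num

/-! ## §3 ★ The kernel second moment -/

/-- ★★ **KERNEL SECOND MOMENT (one-site lattice): `∫_V K_B(U,V)·cfgDist(U,V) dV ≤ (9/B)·linkCE B`** for every `U`, `B > 0` — `K_B ≤ E_B` (magnetic factors
`≤ 1`), the exact electric row moment `3·linkM2·linkC²`, and the sharp one-link second moment `linkM2 ≤ (3/B)·linkC`.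
[cite: MontvayMunster1994, §3.2.3 (3.96)-(3.97) p.121] [cite: SeilerLNP1982, §3] -/
theorem integral_transferKernel_mul_cfgDist_le {B : ℝ} (hB : 0 < B) (U : Cfg) :
    ∫ V, transferKernel su2Rep B U V * cfgDist U V ∂configMeasure SU2 1 ≤ 9 / B * linkCE B := by
  have hB0 : 0 ≤ B := hB.le
  have hint : Integrable (fun V : Cfg => linkE B U V * cfgDist U V) (configMeasure SU2 1) := by
    haveI := secondCountableTopology_su2
    refine integrable_of_measurable_abs_le _ (((continuous_linkE B).comp (continuous_const.prodMk continuous_id)).measurable.mul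
      (measurable_cfgDist_right U)) (C := Real.exp (2 * B) ^ Fintype.card (Edge 3 1) * 24) fun V => ?_
    rw [abs_mul]
    exact mul_le_mul (abs_linkE_le hB0 _ _) (abs_cfgDist_le _ _) (abs_nonneg _) (by positivity)
  have hmono : ∫ V, transferKernel su2Rep B U V * cfgDist U V ∂configMeasure SU2 1 ≤ ∫ V, linkE B U V * cfgDist U V ∂configMeasure SU2 1 :=
    integral_mono_of_nonneg (Eventually.of_forall fun V => mul_nonneg (transferKernel_pos su2Rep B U V).le (cfgDist_nonneg U V)) hint
      (Eventually.of_forall fun V => mul_le_mul_of_nonneg_right (transferKernel_le_linkE hB0 U V) (cfgDist_nonneg U V))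
  have hC : 0 ≤ linkC B := (linkC_pos hB0).le
  calc ∫ V, transferKernel su2Rep B U V * cfgDist U V ∂configMeasure SU2 1
      ≤ ∫ V, linkE B U V * cfgDist U V ∂configMeasure SU2 1 := hmono
    _ = 3 * (linkM2 B * linkC B ^ 2) := integral_linkE_mul_cfgDist hB0 U
    _ ≤ 3 * ((3 / B * linkC B) * linkC B ^ 2) := by
        have := mul_le_mul_of_nonneg_right (linkM2_le_three_div hB) (sq_nonneg (linkC B))
        linarith
    _ = 9 / B * linkCE B := by rw [linkCE, card_edge_one]; ring

/-- The same with the kernel arguments swapped (`cfgDist` and `K_B` are symmetric): `∫_U K_B(U,V)·cfgDist(U,V) dU ≤ (9/B)·linkCE B`. [cite: SeilerLNP1982, §3] -/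
theorem integral_transferKernel_mul_cfgDist_le_left {B : ℝ} (hB : 0 < B) (V : Cfg) :
    ∫ U, transferKernel su2Rep B U V * cfgDist U V ∂configMeasure SU2 1 ≤ 9 / B * linkCE B := by
  have h := integral_transferKernel_mul_cfgDist_le hB V
  have e : ∀ U : Cfg, transferKernel su2Rep B U V * cfgDist U V = transferKernel su2Rep B V U * cfgDist V U := fun U => by
    rw [transferKernel_su2Rep_symm B U V, cfgDist_comm]
  simp_rw [e]
  exact h

/-! ## §4 The row moment in units of `λ₀(B,1)` -/

/-- **`linkCE B ≤ 2·λ₀(B,1)` for `B ≥ B₀`** (the W1-up rung's variational lower bound `(1 − K·λ_b)·c_B^{|E|} ≤ λ₁ ≤ λ₀` at `λ_b(B) ≤ min(4/5, 1/(2K))`).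
[cite: ReedSimonIV1978, Thm. XIII.1] -/
theorem exists_linkCE_le_two_mul_levelValue_zero :
    ∃ B₀ : ℝ, 0 < B₀ ∧ ∀ B : ℝ, B₀ ≤ B → linkCE B ≤ 2 * levelValue su2Rep 1 B 0 := by
  set t : ℝ := min (4 / 5) (1 / (2 * Kcon)) with ht
  have hK := Kcon_pos
  have ht0 : 0 < t := lt_min (by norm_num) (by positivity)
  refine ⟨2 / t ^ 3, by positivity, fun B hB => ?_⟩
  have hB0 : 0 < B := lt_of_lt_of_le (by positivity) hB
  set r := bareLambda B with hr
  have hr0 : 0 < r := bareLambda_pos' hB0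
  have hrt : r ≤ t := bareLambda_le_of_le ht0 hB
  have hr45 : r ≤ 4 / 5 := hrt.trans (min_le_left _ _)
  have hKr : Kcon * r ≤ 1 / 2 := by
    have h1 : r ≤ 1 / (2 * Kcon) := hrt.trans (min_le_right _ _)
    rw [le_div_iff₀ (by positivity)] at h1
    linarith
  have hBr : B * r ^ 3 = 2 := bareLambda_cube hB0
  have hsec := secondValue_ge hB0 hr0 hr45 hBr hKr
  have htop : secondValue su2Rep 1 B ≤ levelValue su2Rep 1 B 0 := by
    rw [levelValue_zero]; exact secondValue_le_topValue su2Rep continuous_su2Rep B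
  have hCE : 0 ≤ linkCE B := (linkCE_pos hB0.le).le
  nlinarith

/-- ★ **Row moment in vacuum units**: `∃ B₀, ∀ B ≥ B₀, ∀ U, ∫_V K_B(U,V)·cfgDist(U,V) dV ≤ (18/B)·λ₀(B,1)`. [cite: MontvayMunster1994, §3.2.3 (3.96)-(3.97) p.121] -/
theorem exists_integral_transferKernel_mul_cfgDist_le_levelValue :
    ∃ B₀ : ℝ, 0 < B₀ ∧ ∀ B : ℝ, B₀ ≤ B → ∀ U : Cfg,
      ∫ V, transferKernel su2Rep B U V * cfgDist U V ∂configMeasure SU2 1 ≤ 18 / B * levelValue su2Rep 1 B 0 := by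
  obtain ⟨B₀, hB₀, h⟩ := exists_linkCE_le_two_mul_levelValue_zero
  refine ⟨B₀, hB₀, fun B hB U => ?_⟩
  have hBpos : 0 < B := hB₀.trans_le hB
  calc _ ≤ 9 / B * linkCE B := integral_transferKernel_mul_cfgDist_le hBpos U
    _ ≤ 9 / B * (2 * levelValue su2Rep 1 B 0) := mul_le_mul_of_nonneg_left (h B hB) (by positivity)
    _ = 18 / B * levelValue su2Rep 1 B 0 := by ring

end Summit.QuantumFields.YangMills.Theorems.FemtoTransferGap.PolyakovLift

end
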